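import Summits.BirchSwinnertonDyer.BirchSwinnertonDyer.Theorems.Rank1ResidualJetSignedGlobalDuality
import Summits.BirchSwinnertonDyer.BirchSwinnertonDyer.Theorems.Rank1ResidualJetSignedGlobalDualityPlus
import Summits.BirchSwinnertonDyer.BirchSwinnertonDyer.Theorems.Rank1ResidualJetPairingCountingPermutationLocal
import Literature.NumberTheory.GaloisCohomology.KolyvaginSystems
import HarnessLib

/-!
# T1 JET (cell `bsd-jet`), road K, stub S1 → row form: the signed counting for a structure RELAXED
# AT ONE `σ`-FIXED PLACE (Jetchev 2008, Lemma 5.2 (iii) at an inert Kolyvagin prime `λ`)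

HONEST FRAMING (programme file `BSD-LIT2PART-PROGRAMME-v1.md` §HONESTY, verbatim): «no tranche here
proves BSD; ARM L moves the LITERAL column of an r ≤ 1 census into the kernel-proved-modulo-named-print
column; ARM P changes what «named print» is worth.» THEOREMS ONLY (seat `bsd-jet-pv-1`, session g5;
`--supports stmt-BirchSwinnertonDyer-14418`, helper): no definition, no named fact, no `sorry`.
Nothing is booked; 0 classes move.

## What

For a `σ`-stable Selmer structure `𝓕` on `E[n]` as in the end product
(`relIndex_selmerGroup_mul_relIndex_dualSelmerGroup_minus ∕ _plus`) and a `σ`-FIXED finite place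
`λ ∈ T` (`σ • λ = λ`), put `𝓕^λ := 𝓕.relaxedAt {λ}` (everything at `λ`). Then for either sign
`s = ±1` (`H^s = ker(conjAct − s)`, `(H^D)^s = ker(conjActDual − s)`):

`[H¹_{𝓕^λ} ∩ H^s : H¹_𝓕 ∩ H^s] · #loc'_λ(H¹_{𝓕^*} ∩ (H^D)^s) = (𝓕_λ).relIndex (ker(σ_{*,λ} − s))`

(`relIndex_mul_natCard_map_eq_of_relaxedAt`), `σ_{*,λ} = conjActPlace W σ n (hλ : σ • λ = λ)` the
local action at the fixed place. This is the shape of the hypothesis `hdual_ℓ` of the cell's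
`JET.tamagawaExponent_le_mInfty_of_rowData` (its `sing` has kernel `H¹_𝓕 ∩ H^s` inside
`H¹_{𝓕^λ} ∩ H^s`; its `C'` is `H¹_{𝓕^*} ∩ (H^D)^s` up to the Weil transport), with the right-hand
side left as the LOCAL index at `λ` (= `p^k` at a Kolyvagin prime of index `≥ k`, Lemma 5.2 (i)–(ii),
supplied separately). Ingredients: the two signed end products, the fixed-place evaluation of the
local index (`relIndex_pi_inf_ker_add_id_eq_of_fixed`), `(𝓕^λ)^*_λ = ⊤^⊥ = 0` (perfectness), and
`[A : A ∩ ker f] = #f(A)`.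

References (locators only; no cited FACT is declared): [cite: Jetchev2008, §5 Thm. 5.1, Lemma 5.2
(p. 822), proof of Thm. 6.3 (p. 823)] [cite: Howard2004HeegnerKolyvagin, Thm. 2.1.11]
[cite: MilneADT2006, Ch. I, Cor. 2.3]. Design: no definitions; universe `u` for `K`. Axioms:
`propext`, `Classical.choice`, `Quot.sound`.
-/

set_option autoImplicit false

noncomputable section

open scoped Classical
open Function NumberField IsDedekindDomain WeierstrassCurve Field
open Literature.NumberTheory.EllipticCurves Literature.NumberTheory.GaloisRepresentations
open Literature.NumberTheory.GaloisCohomology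
open Literature.NumberTheory.GaloisRepresentations.DiscreteGaloisModule (localTatePairingZMod
  tateDual SelmerStructure)

universe u

namespace Summit.BirchSwinnertonDyer.Rank1Residual.JET.GlobalDuality

/-! ### Sign bookkeeping: `ker(c − (±1)•id)` -/

section Signs

variable {X : Type*} [AddCommGroup X] (c : X →+ X)

/-- `ker(c − (−1) • id) = ker(c + id)`. -/
theorem ker_sub_neg_one_zsmul_id : (c - (-1 : ℤ) • AddMonoidHom.id X).ker = (c + AddMonoidHom.id X).ker := by
  ext x
  simp only [AddMonoidHom.mem_ker, AddMonoidHom.add_apply, neg_one_zsmul, sub_neg_eq_add]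

/-- `ker(c − 1 • id) = ker(c − id)`. -/
theorem ker_sub_one_zsmul_id : (c - (1 : ℤ) • AddMonoidHom.id X).ker = (c - AddMonoidHom.id X).ker := by
  ext x
  simp only [AddMonoidHom.mem_ker, AddMonoidHom.sub_apply, AddMonoidHom.id_apply, one_zsmul]

/-- `ker(−c + id) = ker(c − id)`. -/
theorem ker_neg_add_id : (-c + AddMonoidHom.id X).ker = (c - AddMonoidHom.id X).ker := by
  ext x
  simp only [AddMonoidHom.mem_ker, AddMonoidHom.add_apply, AddMonoidHom.neg_apply,
    AddMonoidHom.sub_apply, AddMonoidHom.id_apply]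
  rw [neg_add_eq_sub, ← neg_sub, neg_eq_zero]

/-- `ker(−c − id) = ker(c + id)`. -/
theorem ker_neg_sub_id : (-c - AddMonoidHom.id X).ker = (c + AddMonoidHom.id X).ker := by
  ext x
  simp only [AddMonoidHom.mem_ker, AddMonoidHom.add_apply, AddMonoidHom.neg_apply,
    AddMonoidHom.sub_apply, AddMonoidHom.id_apply]
  rw [← neg_add', neg_eq_zero]

end Signs

/-! ### The dual of the relaxed condition is zero (perfectness) -/

section DualTop

variable {K : Type u} [Field K] [NumberField K] {N : ℕ}
  {M : Type u} [AddCommGroup M] [TopologicalSpace M] [DiscreteTopology M] [Finite M]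

/-- **`⊤^⊥ = 0`**: the dual local condition of the relaxed condition `H¹(K_v, M)` is zero, for a family
with local Tate duality at `v` (right adjoint injective). [cite: Howard2004HeegnerKolyvagin, Def. 2.1.6]
[cite: MilneADT2006, Ch. I, Cor. 2.3] -/
theorem dualLocalCondition_top_eq_bot (inv : LocalInvariants K N) (hperf : inv.IsPerfect)
    (ρ : DiscreteGaloisModule K M) (hM : ∀ m : M, N • m = 0) (v : HeightOneSpectrum (𝓞 K)) :
    inv.dualLocalCondition ρ (Sum.inr v : Place K) ⊤ = ⊥ := by
  rw [eq_bot_iff]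
  intro y hy
  rw [LocalInvariants.mem_dualLocalCondition_iff] at hy
  rw [AddSubgroup.mem_bot]
  apply ((hperf v).2 ρ hM).2.injective
  ext a
  rw [AddMonoidHom.flip_apply, hy a (AddSubgroup.mem_top a), map_zero, AddMonoidHom.zero_apply]

end DualTop

/-! ### The relaxed structure `𝓕^λ` -/

section Relaxed

variable {K : Type u} [Field K] [NumberField K] (W : WeierstrassCurve ℚ) (σ : K ≃ₐ[ℚ] K) (n : ℤ)
  {N : ℕ}

/-- `𝓕 ≤ 𝓕^λ`. -/
theorem le_relaxedAt (𝓕 : SelmerStructure ((W.baseChange K).torsionGaloisModule n))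
    (a : Finset (HeightOneSpectrum (𝓞 K))) : 𝓕 ≤ 𝓕.relaxedAt a := by
  intro v
  change 𝓕 v ≤ 𝓕.modify 𝓕 a ∅ ∅ v
  rcases v with w | v
  · exact le_of_eq (SelmerStructure.modify_inl _ _ _ _ _ w).symm
  · by_cases hv : v ∈ a
    · rw [SelmerStructure.modify_inr_of_mem_relaxed _ _ hv]; exact le_top
    · rw [SelmerStructure.modify_inr_of_not_mem _ _ hv (Finset.notMem_empty v) (Finset.notMem_empty v)]

/-- `𝓕^λ` is unramified outside `S` when `𝓕` is and `λ ∈ S`. [cite: Howard2004HeegnerKolyvagin, Def. 2.1.10] -/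
theorem relaxedAt_isUnramifiedOutside {𝓕 : SelmerStructure ((W.baseChange K).torsionGaloisModule n)}
    {S : Finset (Place K)} (h𝓕 : 𝓕.IsUnramifiedOutside S) {l : HeightOneSpectrum (𝓞 K)}
    (hl : (Sum.inr l : Place K) ∈ S) : (𝓕.relaxedAt {l}).IsUnramifiedOutside S := by
  refine ⟨h𝓕.1, fun v hv => ?_⟩
  have hvl : v ∉ ({l} : Finset (HeightOneSpectrum (𝓞 K))) := by
    rw [Finset.mem_singleton]; rintro rfl; exact hv hl
  change 𝓕.modify 𝓕 {l} ∅ ∅ (Sum.inr v) = _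
  rw [SelmerStructure.modify_inr_of_not_mem _ _ hvl (Finset.notMem_empty v) (Finset.notMem_empty v)]
  exact h𝓕.2 v hv

/-- `𝓕^λ` at a finite place `v ≠ λ` is `𝓕_v`. -/
theorem relaxedAt_inr_of_ne (𝓕 : SelmerStructure ((W.baseChange K).torsionGaloisModule n))
    {l v : HeightOneSpectrum (𝓞 K)} (hv : v ≠ l) : 𝓕.relaxedAt {l} (Sum.inr v) = 𝓕 (Sum.inr v) := by
  have hvl : v ∉ ({l} : Finset (HeightOneSpectrum (𝓞 K))) := by rwa [Finset.mem_singleton]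
  change 𝓕.modify 𝓕 {l} ∅ ∅ (Sum.inr v) = _
  rw [SelmerStructure.modify_inr_of_not_mem _ _ hvl (Finset.notMem_empty v) (Finset.notMem_empty v)]

/-- `𝓕^λ` at `λ` is everything. -/
theorem relaxedAt_inr_self (𝓕 : SelmerStructure ((W.baseChange K).torsionGaloisModule n))
    (l : HeightOneSpectrum (𝓞 K)) : 𝓕.relaxedAt {l} (Sum.inr l) = ⊤ := by
  change 𝓕.modify 𝓕 {l} ∅ ∅ (Sum.inr l) = _
  rw [SelmerStructure.modify_inr_of_mem_relaxed _ _ (Finset.mem_singleton_self l)]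

/-- `𝓕^λ` at an infinite place is `𝓕`. -/
theorem relaxedAt_inl (𝓕 : SelmerStructure ((W.baseChange K).torsionGaloisModule n))
    (l : HeightOneSpectrum (𝓞 K)) (w : InfinitePlace K) : 𝓕.relaxedAt {l} (Sum.inl w) = 𝓕 (Sum.inl w) :=
  SelmerStructure.modify_inl _ _ _ _ _ w

/-- `σ`-stability passes to `𝓕^λ` for a `σ`-fixed `λ`. -/
theorem conjActPlace_mem_relaxedAt
    {𝓕 : SelmerStructure ((W.baseChange K).torsionGaloisModule n)}
    (h𝓕σ : ∀ (v w : HeightOneSpectrum (𝓞 K)) (h : σ • v = w)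
      (x : galoisCohomology (((W.baseChange K).torsionGaloisModule n).toLocal (Sum.inr v : Place K)) 1),
      x ∈ 𝓕 (Sum.inr v) → conjActPlace W σ n h x ∈ 𝓕 (Sum.inr w))
    {l : HeightOneSpectrum (𝓞 K)} (hl : σ • l = l)
    (v w : HeightOneSpectrum (𝓞 K)) (h : σ • v = w)
    (x : galoisCohomology (((W.baseChange K).torsionGaloisModule n).toLocal (Sum.inr v : Place K)) 1)
    (hx : x ∈ 𝓕.relaxedAt {l} (Sum.inr v)) : conjActPlace W σ n h x ∈ 𝓕.relaxedAt {l} (Sum.inr w) := by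
  by_cases hw : w = l
  · subst hw; rw [relaxedAt_inr_self]; trivial
  · have hv : v ≠ l := by
      rintro rfl; exact hw (h ▸ hl)
    rw [relaxedAt_inr_of_ne W n 𝓕 hw]
    rw [relaxedAt_inr_of_ne W n 𝓕 hv] at hx
    exact h𝓕σ v w h x hx

/-- **The dual Selmer group of `𝓕^λ` is the kernel of `loc'_λ` on the dual Selmer group of `𝓕`**
(`(𝓕^λ)^*` agrees with `𝓕^*` off `λ` and is `⊤^⊥ = 0` at `λ`). [cite: Jetchev2008, Lemma 5.2 (iii) (p. 822)]
[cite: Howard2004HeegnerKolyvagin, Def. 2.1.6, Thm. 2.1.11] -/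
theorem selmerGroup_dualSelmerStructure_relaxedAt [Finite (geomTorsion (W.baseChange K) n)]
    (inv : LocalInvariants K N) (hperf : inv.IsPerfect)
    (hM : ∀ P : geomTorsion (W.baseChange K) n, N • P = 0)
    (𝓕 : SelmerStructure ((W.baseChange K).torsionGaloisModule n)) (l : HeightOneSpectrum (𝓞 K)) :
    (inv.dualSelmerStructure ((W.baseChange K).torsionGaloisModule n) (𝓕.relaxedAt {l})).selmerGroup =
      (inv.dualSelmerStructure ((W.baseChange K).torsionGaloisModule n) 𝓕).selmerGroup ⊓
        (galoisCohomology.localization (((W.baseChange K).torsionGaloisModule n).tateDual N)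
          (Sum.inr l : Place K) 1).ker := by
  ext y
  rw [AddSubgroup.mem_inf, SelmerStructure.mem_selmerGroup_iff, SelmerStructure.mem_selmerGroup_iff,
    AddMonoidHom.mem_ker]
  constructor
  · intro h
    refine ⟨fun v => ?_, ?_⟩
    · rcases v with w | v
      · have := h (Sum.inl w)
        rwa [LocalInvariants.dualSelmerStructure_apply, relaxedAt_inl,
          ← LocalInvariants.dualSelmerStructure_apply] at this
      · by_cases hv : v = l
        · subst hv
          have := h (Sum.inr v)
          rw [LocalInvariants.dualSelmerStructure_apply, relaxedAt_inr_self,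
            dualLocalCondition_top_eq_bot inv hperf _ hM, AddSubgroup.mem_bot] at this
          rw [LocalInvariants.dualSelmerStructure_apply, this]; exact zero_mem _
        · have := h (Sum.inr v)
          rwa [LocalInvariants.dualSelmerStructure_apply, relaxedAt_inr_of_ne W n 𝓕 hv,
            ← LocalInvariants.dualSelmerStructure_apply] at this
    · have := h (Sum.inr l)
      rwa [LocalInvariants.dualSelmerStructure_apply, relaxedAt_inr_self,
        dualLocalCondition_top_eq_bot inv hperf _ hM, AddSubgroup.mem_bot] at this
  · rintro ⟨h, h0⟩ v
    rcases v with w | v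
    · rw [LocalInvariants.dualSelmerStructure_apply, relaxedAt_inl, ← LocalInvariants.dualSelmerStructure_apply]
      exact h (Sum.inl w)
    · by_cases hv : v = l
      · subst hv; rw [h0]; exact zero_mem _
      · rw [LocalInvariants.dualSelmerStructure_apply, relaxedAt_inr_of_ne W n 𝓕 hv,
          ← LocalInvariants.dualSelmerStructure_apply]
        exact h (Sum.inr v)

end Relaxed

/-! ### The signed counting for `𝓕 ≤ 𝓕^λ` at a `σ`-fixed place -/

section Main

variable {K : Type u} [Field K] [NumberField K] (W : WeierstrassCurve ℚ) (σ : K ≃ₐ[ℚ] K) (n : ℤ)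
  {N : ℕ} [NeZero N] [Finite (geomTorsion (W.baseChange K) n)]

/-- **Signed Poitou–Tate counting for `𝓕 ≤ 𝓕^λ` at a `σ`-FIXED place `λ`** (Jetchev 2008,
Lemma 5.2 (iii) at an inert Kolyvagin prime, either sign `s = ±1`). Setting as in the end product
`relIndex_selmerGroup_mul_relIndex_dualSelmerGroup_minus` (a `σ`-stable structure `𝓕` on `E[n]`
unramified outside `S`, `T` the `σ`-stable set of finite places of `S`, `inv` with local duality,
Poitou–Tate vanishing, Howard's complement property and conjugation compatibility), `λ ∈ T` with
`σ • λ = λ`, `𝓕^λ = 𝓕.relaxedAt {λ}`: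

`[H¹_{𝓕^λ} ∩ H^s : H¹_𝓕 ∩ H^s] · #loc'_λ(H¹_{𝓕^*} ∩ (H^D)^s) = (𝓕_λ).relIndex (ker(σ_{*,λ} − s))`,

`H^s = ker(conjAct − s)`, `(H^D)^s = ker(conjActDual − s)`, `σ_{*,λ} = conjActPlace W σ n hλ` the action
of `σ` on `H¹(K_λ, E[n])`. The first factor is `#im(sing)` and the second `#loc_λ(C')` of the
hypothesis `hdual_ℓ` of `JET.tamagawaExponent_le_mInfty_of_rowData` (up to the Weil transport of
`C'`); the right side is the local term of Lemma 5.2 (i)–(ii). PROOF: the signed end products for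
`𝓕 ≤ 𝓕^λ`, the local index at a fixed place (`relIndex_pi_inf_ker_add_id_eq_of_fixed`, with `−τ_X`
for `s = 1`), `H¹_{(𝓕^λ)^*} = H¹_{𝓕^*} ∩ ker loc'_λ` (`⊤^⊥ = 0`) and `[A : A ∩ ker f] = #f(A)`.
[cite: Jetchev2008, §5 Thm. 5.1, Lemma 5.2 (p. 822), proof of Thm. 6.3 (p. 823)]
[cite: Howard2004HeegnerKolyvagin, Thm. 2.1.11] [cite: MilneADT2006, Ch. I, Cor. 2.3] -/
theorem relIndex_mul_natCard_map_eq_of_relaxedAt (hσ : σ * σ = 1) (hN : Odd N)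
    (hM : ∀ P : geomTorsion (W.baseChange K) n, N • P = 0)
    (inv : LocalInvariants K N) (hperf : inv.IsPerfect) (hvan : inv.SumLocalTermEqZero)
    (hSC : inv.SelmerComplement) (hinv : inv.IsConjCompatible σ)
    (S : Finset (Place K)) (T : Finset (HeightOneSpectrum (𝓞 K)))
    (hT : ∀ v, (Sum.inr v : Place K) ∈ S ↔ v ∈ T) (hTσ : ∀ t ∈ T, σ • t ∈ T)
    (hS : ∀ v : HeightOneSpectrum (𝓞 K), (Sum.inr v : Place K) ∉ S →
      ((N : ℕ) : 𝓞 K) ∉ v.asIdeal ∧ GaloisRep.IsUnramifiedAt v ((W.baseChange K).torsionGaloisModule n))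
    {𝓕 : SelmerStructure ((W.baseChange K).torsionGaloisModule n)}
    (h𝓕 : 𝓕.IsUnramifiedOutside S)
    (h𝓕σ : ∀ (v w : HeightOneSpectrum (𝓞 K)) (h : σ • v = w)
      (x : galoisCohomology (((W.baseChange K).torsionGaloisModule n).toLocal (Sum.inr v : Place K)) 1),
      x ∈ 𝓕 (Sum.inr v) → conjActPlace W σ n h x ∈ 𝓕 (Sum.inr w))
    (h𝓕inf : ∀ w : InfinitePlace K, 𝓕 (Sum.inl w) = ⊤)
    (h𝓕dinf : ∀ w : InfinitePlace K,
      inv.dualSelmerStructure ((W.baseChange K).torsionGaloisModule n) 𝓕 (Sum.inl w) = ⊤)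
    {l : HeightOneSpectrum (𝓞 K)} (hlT : l ∈ T) (hl : σ • l = l) {s : ℤ} (hs : s = 1 ∨ s = -1) :
    (𝓕.selmerGroup ⊓ (conjAct W σ n - s • AddMonoidHom.id _).ker).relIndex
        ((𝓕.relaxedAt {l}).selmerGroup ⊓ (conjAct W σ n - s • AddMonoidHom.id _).ker) *
      Nat.card (((inv.dualSelmerStructure ((W.baseChange K).torsionGaloisModule n) 𝓕).selmerGroup ⊓
          (conjActDual W σ n N - s • AddMonoidHom.id _).ker).map
        (galoisCohomology.localization (((W.baseChange K).torsionGaloisModule n).tateDual N)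
          (Sum.inr l : Place K) 1)) =
      (𝓕 (Sum.inr l)).relIndex ((conjActPlace W σ n hl - s • AddMonoidHom.id _).ker) := by
  -- (the permutation layer's `Pi.single` uses the classical `DecidableEq` on the index type)
  letI : DecidableEq T := fun a b => Classical.propDecidable (a = b)
  -- the relaxed structure and its properties
  have hle : 𝓕 ≤ 𝓕.relaxedAt {l} := le_relaxedAt W n 𝓕 {l}
  have hlS : (Sum.inr l : Place K) ∈ S := (hT l).mpr hlT
  have h𝓖 : (𝓕.relaxedAt {l}).IsUnramifiedOutside S := relaxedAt_isUnramifiedOutside W n h𝓕 hlS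
  have h𝓖σ := conjActPlace_mem_relaxedAt W σ n h𝓕σ hl
  have h𝓖inf : ∀ w : InfinitePlace K, 𝓕.relaxedAt {l} (Sum.inl w) = ⊤ := fun w => by
    rw [relaxedAt_inl, h𝓕inf]
  -- transport data (the two place involutions coincide: both are `σ • ·`)
  obtain ⟨π, eX, τX, hπ, hπσ, heX, hτX, -, -⟩ := exists_piTransport_conjActPlace W σ n hσ T hTσ
  obtain ⟨π', eY, τY, -, hπσ', heY, hτY, -, -⟩ := exists_piTransport_conjActPlaceDual W σ n N hσ T hTσ
  have hππ : π = π' := funext fun j => Subtype.ext ((hπσ j).trans (hπσ' j).symm)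
  subst hππ
  -- the fixed index
  set j₀ : T := ⟨l, hlT⟩ with hj₀
  have hj : π j₀ = j₀ := Subtype.ext (by rw [hπσ]; exact hl)
  have hoff : ∀ i : T, i ≠ j₀ → 𝓕 (Sum.inr (i : HeightOneSpectrum (𝓞 K))) =
      𝓕.relaxedAt {l} (Sum.inr (i : HeightOneSpectrum (𝓞 K))) := fun i hi => by
    rw [relaxedAt_inr_of_ne W n 𝓕 (fun h => hi (Subtype.ext h))]
  -- the `j₀`-coordinate of `τ_X` is `σ_{*,λ}` applied to the `j₀`-coordinate
  have hfix : ∀ x : ∀ i : T, galoisCohomology (((W.baseChange K).torsionGaloisModule n).toLocal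
      (Sum.inr (i : HeightOneSpectrum (𝓞 K)) : Place K)) 1, τX x j₀ = conjActPlace W σ n hl (x j₀) :=
    fun x => by rw [hτX, apply_apply_congr eX x j₀ hj, heX j₀ j₀ hl]
  -- the dual factor: `[H¹_{𝓕^*} ∩ Y^s : H¹_{(𝓕^λ)^*} ∩ Y^s] = #loc'_λ (H¹_{𝓕^*} ∩ Y^s)`
  have hdual : ((inv.dualSelmerStructure ((W.baseChange K).torsionGaloisModule n)
        (𝓕.relaxedAt {l})).selmerGroup ⊓ (conjActDual W σ n N - s • AddMonoidHom.id _).ker).relIndex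
      ((inv.dualSelmerStructure ((W.baseChange K).torsionGaloisModule n) 𝓕).selmerGroup ⊓
        (conjActDual W σ n N - s • AddMonoidHom.id _).ker) =
      Nat.card (((inv.dualSelmerStructure ((W.baseChange K).torsionGaloisModule n) 𝓕).selmerGroup ⊓
          (conjActDual W σ n N - s • AddMonoidHom.id _).ker).map
        (galoisCohomology.localization (((W.baseChange K).torsionGaloisModule n).tateDual N)
          (Sum.inr l : Place K) 1)) := by
    rw [selmerGroup_dualSelmerStructure_relaxedAt W n inv hperf hM 𝓕 l, inf_right_comm,
      AddSubgroup.inf_relIndex_left, AddSubgroup.relIndex_ker]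
  rcases hs with rfl | rfl
  · -- `s = 1`: the `+` parts
    have hend := relIndex_selmerGroup_mul_relIndex_dualSelmerGroup_plus W σ n hσ hN hM inv hperf hvan
      hSC hinv S T hT hS hle h𝓕 h𝓖 h𝓕σ h𝓖σ h𝓕inf h𝓖inf h𝓕dinf π hπ hπσ eX heX τX hτX eY heY τY hτY
    rw [← hdual]
    simp only [ker_sub_one_zsmul_id]
    rw [hend]
    -- evaluate the local index with the involution `−τ_X` (transports `−eX`)
    have hτX' : ∀ x j, (-τX) x j = (fun i j => -(eX i j)) (π j) j (x (π j)) := fun x j => by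
      rw [AddMonoidHom.neg_apply, Pi.neg_apply, hτX, AddMonoidHom.neg_apply]
    rw [← ker_neg_add_id τX,
      relIndex_pi_inf_ker_add_id_eq_of_fixed π (fun i j => -(eX i j)) (-τX) hτX' _ _ hπ j₀ hj hoff,
      relaxedAt_inr_self, top_inf_eq, ← ker_neg_add_id (conjActPlace W σ n hl)]
    -- the local involution at `j₀` is `conjActPlace W σ n hl`
    congr 2
    ext y
    simp only [AddMonoidHom.add_apply, AddMonoidHom.comp_apply, AddMonoidHom.neg_apply, Pi.neg_apply,
      Pi.evalAddMonoidHom_apply, AddMonoidHom.id_apply]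
    rw [hfix, AddMonoidHom.single_apply, Pi.single_eq_same]
    rfl
  · -- `s = −1`: the `−` parts
    have hend := relIndex_selmerGroup_mul_relIndex_dualSelmerGroup_minus W σ n hσ hN hM inv hperf hvan
      hSC hinv S T hT hS hle h𝓕 h𝓖 h𝓕σ h𝓖σ h𝓕inf h𝓖inf h𝓕dinf π hπ hπσ eX heX τX hτX eY heY τY hτY
    rw [← hdual]
    simp only [ker_sub_neg_one_zsmul_id]
    rw [hend, relIndex_pi_inf_ker_add_id_eq_of_fixed π eX τX hτX _ _ hπ j₀ hj hoff, relaxedAt_inr_self,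
      top_inf_eq]
    -- the local involution at `j₀` is `conjActPlace W σ n hl`
    congr 2
    ext y
    simp only [AddMonoidHom.add_apply, AddMonoidHom.comp_apply, Pi.evalAddMonoidHom_apply,
      AddMonoidHom.id_apply]
    rw [hfix, AddMonoidHom.single_apply, Pi.single_eq_same]
    rfl

end Main

end Summit.BirchSwinnertonDyer.Rank1Residual.JET.GlobalDuality

end
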